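import Mathlib

/-!
# A kernel-checked witness: the union cluster `C(a₁) ∪ C(a₂)` is NOT positively associated given
`a₁ ↮ a₂` (blind cell PercRepro2, p5 g14; `proofs/P5-OEDGE.md` §10)

Bernoulli bond percolation on the 5-vertex graph with vertices `0..4`, roots `a₁ = 3`, `a₂ = 4`,
marks `b = 2`, `o = 1`, and the six edges (weights in units of `1/64`)

  `{0,1}: 4`, `{1,4}: 60`, `{0,2}: 32`, `{0,3}: 63`, `{2,3}: 32`, `{0,4}: 60`

(i.e. `p = 1/16, 15/16, 1/2, 63/64, 1/2, 15/16`).  Let `Q = {3 ↮ 4}`, `U = C(3) ∪ C(4)` and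
`U_v = 1[v ∈ U]`.  Then, with the masses in units of `64^{-6}`,

  `massQ = 4801232896`, `massb = 3521970176` (`Q, b ∈ U`), `masso = 4505141248` (`Q, o ∈ U`),
  `massbo = 3304652800` (`Q, b ∈ U, o ∈ U`),

so `P(Q) = 73261/1048576` and `Cov_{P(·|Q)}(U_b, U_o) = massbo/massQ − (massb/massQ)(masso/massQ)
= −2158/87986461 < 0`: the two increasing events `{b ∈ U}`, `{o ∈ U}` of the union cluster are
NEGATIVELY correlated given `a₁ ↮ a₂` — the union-of-two-clusters analogue of BHK06 Theorem 1.1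
fails, and the A-world term `−ν(A)·Cov_{ν|A}(U_b, U_o)` of the cell's covariance form (HCOV) has
either sign (adding a third root `a₃` pendant at `a₂` makes `{a₃ ∉ U}` = «the pendant closed» and
`ν(· | A)` this instance).  Everything is a finite sum over the `2^6` configurations; the four masses
are established by `decide` (kernel evaluation, standard axioms only) and the inequality by
`norm_num`.  Found by the cell's o-edge census (kit j267462, 329 / 1,828,916 instances with
`Cov_{ν|A}(U_b, U_o) < 0`); re-derived exactly by two independent implementations of this seat
(`hcovlib`-based and a BFS evaluator) and by this file.
-/

namespace Summit.Ventures.PercRepro2.UnionNotPA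

/-- An undirected edge `{u, v}` open with probability `w / 64`. -/
structure UEdge where
  u : Nat
  v : Nat
  w : Nat

/-- The six edges of the witness (vertices `0..4`). -/
def edge : Nat → UEdge
  | 0 => ⟨0, 1, 4⟩    -- {0,1}, p = 1/16
  | 1 => ⟨1, 4, 60⟩   -- {1,4}, p = 15/16
  | 2 => ⟨0, 2, 32⟩   -- {0,2}, p = 1/2
  | 3 => ⟨0, 3, 63⟩   -- {0,3}, p = 63/64
  | 4 => ⟨2, 3, 32⟩   -- {2,3}, p = 1/2
  | _ => ⟨0, 4, 60⟩   -- {0,4}, p = 15/16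

/-- The roots `a₁ = 3`, `a₂ = 4` and the marks `b = 2`, `o = 1`. -/
def a₁ : Nat := 3
/-- `a₂ = 4`. -/
def a₂ : Nat := 4
/-- `b = 2`. -/
def b : Nat := 2
/-- `o = 1`. -/
def o : Nat := 1

/-- Edge `i` is open in the configuration `c ∈ [0, 2^6)` iff bit `i` of `c` is set. -/
def isOpen (c i : Nat) : Bool := c.testBit i

/-- Product Bernoulli weight of the configuration `c`, in units of `64^{-6}`. -/
def wt (c : Nat) : Nat :=
  (List.range 6).foldl (fun a i => a * (if isOpen c i then (edge i).w else 64 - (edge i).w)) 1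

/-- `x ∈ S` for a vertex bitmask `S`. -/
def mem (S x : Nat) : Bool := S.testBit x

/-- One BFS step along the open edges (both directions). -/
def step (c S : Nat) : Nat :=
  (List.range 6).foldl (fun T i =>
    if isOpen c i then
      let T₁ := if mem T (edge i).u then T ||| (1 <<< (edge i).v) else T
      if mem T₁ (edge i).v then T₁ ||| (1 <<< (edge i).u) else T₁
    else T) S

/-- `n` BFS steps. -/
def iter (c : Nat) : Nat → Nat → Nat
  | 0, S => S
  | n + 1, S => iter c n (step c S)

/-- The open cluster of `v` as a vertex bitmask (5 steps suffice on 5 vertices). -/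
def cluster (c v : Nat) : Nat := iter c 5 (1 <<< v)

/-- `Q = {a₁ ↮ a₂}`. -/
def Q (c : Nat) : Bool := !(mem (cluster c a₁) a₂)

/-- `U = C(a₁) ∪ C(a₂)`. -/
def U (c : Nat) : Nat := cluster c a₁ ||| cluster c a₂

/-- `b ∈ U`. -/
def Ub (c : Nat) : Bool := mem (U c) b
/-- `o ∈ U`. -/
def Uo (c : Nat) : Bool := mem (U c) o

/-- `P(Q)` in units of `64^{-6}`. -/
def massQ : Nat := (List.range 64).foldl (fun a c => if Q c then a + wt c else a) 0
/-- `P(Q, b ∈ U)`. -/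
def massb : Nat := (List.range 64).foldl (fun a c => if Q c && Ub c then a + wt c else a) 0
/-- `P(Q, o ∈ U)`. -/
def masso : Nat := (List.range 64).foldl (fun a c => if Q c && Uo c then a + wt c else a) 0
/-- `P(Q, b ∈ U, o ∈ U)`. -/
def massbo : Nat :=
  (List.range 64).foldl (fun a c => if Q c && Ub c && Uo c then a + wt c else a) 0

/-- The weights sum to `64^6`. -/
theorem total_mass : (List.range 64).foldl (fun a c => a + wt c) 0 = 64 ^ 6 := by decide +kernel

/-- `massQ = 4801232896`. -/
theorem massQ_eq : massQ = 4801232896 := by decide +kernel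
/-- `massb = 3521970176`. -/
theorem massb_eq : massb = 3521970176 := by decide +kernel
/-- `masso = 4505141248`. -/
theorem masso_eq : masso = 4505141248 := by decide +kernel
/-- `massbo = 3304652800`. -/
theorem massbo_eq : massbo = 3304652800 := by decide +kernel

/-- `P(Q) = 73261/1048576`. -/
theorem probQ : (massQ : ℚ) / 64 ^ 6 = 73261 / 1048576 := by rw [massQ_eq]; norm_num

/-- **The conditional covariance of `U_b`, `U_o` given `Q` is `−2158/87986461 < 0`.** -/
theorem conditional_covariance :
    (massbo : ℚ) / massQ - ((massb : ℚ) / massQ) * ((masso : ℚ) / massQ) = -2158 / 87986461 := by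
  rw [massQ_eq, massb_eq, masso_eq, massbo_eq]; norm_num

/-- **The union cluster is not positively associated given `a₁ ↮ a₂`**:
`P(Q)·P(Q, b ∈ U, o ∈ U) < P(Q, b ∈ U)·P(Q, o ∈ U)`. -/
theorem union_cluster_not_PA : massQ * massbo < massb * masso := by
  rw [massQ_eq, massb_eq, masso_eq, massbo_eq]; norm_num

end Summit.Ventures.PercRepro2.UnionNotPA
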